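import Literature.Geometry.Manifold.FlowBoxFlow
import Literature.Geometry.Lorentzian.StationaryOrbitRelation
import HarnessLib

/-!
# Local slices of the stationary flow (Anderson 2000, §0: `π : M → S` is a principal `ℝ`-bundle)

M. T. Anderson, *On stationary vacuum solutions to the Einstein equations*, Ann. Henri Poincaré 1
(2000), §0: "Let `S` be the orbit space of the action `G`. Then `S` is a smooth 3-manifold and the
projection `π : M → S` is a principle `ℝ`-bundle, with fiber `G`." The local content of this
sentence is the existence of **slices**: small transversals to the stationary Killing field `X`
meeting every orbit at most once, onto which a tube of orbit segments retracts along the flow. This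
file constructs them (`IsStationaryKilling.exists_slice`) for a smooth time-oriented Lorentzian
manifold `(M, g, τ)` modelled on a finite-dimensional normed space `E` (charts valued in `E`, as for
`Spacetime d` with `E = EuclideanSpace ℝ (Fin d)`), Hausdorff, chronological, with a complete
Killing field `X` timelike at every point and its flow `θ`:

about every point `p` there are a chart `ψ` of the maximal `C^∞` atlas in which `X` is the constant
field `v = X p` (flow box, `Literature.Geometry.Manifold.exists_flowBox_flow_eq`, Lee 2012,
Thm. 9.22), a functional `ℓ` with `ℓ v = 1` (projection `P z = z - ℓ(z) v` onto `ker ℓ`), an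
`ε > 0`, an open tube `T ∋ p` inside the box and an open set `D₀ ∋ 0` of parameters, such that for
the slice `σ w = ψ⁻¹(ψ p + w)`, `w ∈ D₀ ∩ ker ℓ`:
* the slice lies in `T`, and on `T` the flow is translation by `s v` in the chart for `|s| < ε`;
* every `y ∈ T` retracts into the slice along the flow in time `-ℓ(ψ y - ψ p)` of size `< ε`:
  `θ(-ℓ(ψ y - ψ p), y) = σ(P(ψ y - ψ p))`;
* the slice meets each orbit at most once, and only at flow time `0`:
  `θ(t, σ w) = σ w' ⟹ t = 0 ∧ w = w'` — by the **no-early-return** property of chronological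
  stationary space-times (`IsStationaryKilling.exists_nhds_abs_lt_of_flow_mem`,
  `StationaryOrbitRelation.lean`: an orbit leaving a small neighbourhood returns only after flow
  time `< ε`, which inside the box forces `t = 0`).
Consequently `σ` is a continuous local section of `π` over the open set `π(T)`, and
`y ↦ (P(ψ y - ψ p), ℓ(ψ y - ψ p))` trivialises the flow on `T` — the local triviality of `π`. The
charts of the orbit space built from these slices are in `StationaryOrbitSpace.lean` and its
sequels. Everything is proved; no definitions, no named facts.

## References

* M. T. Anderson, Ann. Henri Poincaré 1 (2000) 977–994, arXiv:gr-qc/0001091, §0 (key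
  `Anderson2000`).
* J. M. Lee, *Introduction to Smooth Manifolds*, 2nd ed., GTM 218 (2012), Thm. 9.22 (flow box),
  Thm. 21.10 (quotients by free proper actions: slices) (key `LeeSmoothManifolds2013`).
* B. O'Neill, *Semi-Riemannian geometry* (1983), Ch. 9 (flows of Killing fields) (key `ONeill1983`).
-/

noncomputable section

open Bundle Set Filter Function Manifold TopologicalSpace
open scoped ContDiff Topology Manifold
namespace Literature.Geometry.Lorentzian

namespace LorentzianMetric

section Slice

variable {E : Type*} [NormedAddCommGroup E] [NormedSpace ℝ E] [FiniteDimensional ℝ E]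
  [CompleteSpace E] {M : Type*} [TopologicalSpace M] [ChartedSpace E M]
  [IsManifold 𝓘(ℝ, E) ∞ M] [T2Space M]
  {g : LorentzianMetric 𝓘(ℝ, E) ∞ M} [g.HasLeviCivita] {τ : TimeOrientation g}
  {X : Π x : M, TangentSpace 𝓘(ℝ, E) x} {θ : ℝ × M → M}

/-- **Local slices of the stationary flow** (Anderson 2000, §0: the projection `π : M → S` onto
the orbit space "is a principle `ℝ`-bundle", i.e. locally trivial; O'Neill 1983, Ch. 9 / Lee 2012,
Thm. 9.22 and Thm. 21.10 for the differential-topological mechanism). Let `(M, g, τ)` be a smooth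
time-oriented Lorentzian manifold modelled on the finite-dimensional space `E`, Hausdorff, carrying
a stationary Killing field `X` timelike at every point, chronological, with flow `θ`. Then every
point `p` has: a chart `ψ` of the maximal atlas straightening `X` to `v = X p`, a functional `ℓ`
with `ℓ v = 1` (so that `E = ker ℓ ⊕ ℝ v`, with projection `P z = z - ℓ(z) v`), an `ε > 0`, an open
neighbourhood `T ⊆ ψ.source` of `p` and an open `D₀ ∋ 0` in `E`, such that, writing
`σ w = ψ⁻¹(ψ p + w)` for the **slice** through `p` (`w ∈ D₀ ∩ ker ℓ`):
(i) the slice lies in `T`; (ii) on `T` the flow is translation in the chart for times `|s| < ε`;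
(iii) every `y ∈ T` is carried **into the slice** by the flow in time `-ℓ(ψ y - ψ p)`, of size `< ε`:
`θ(-ℓ(ψ y - ψ p), y) = σ(P(ψ y - ψ p))`; (iv) the slice meets every orbit **at most once**, and only
at flow time `0`: `θ(t, σ w) = σ w' ⟹ t = 0 ∧ w = w'` (no early returns,
`exists_nhds_abs_lt_of_flow_mem`, plus the chart identity). Thus `σ` is a local section of `π`
over the open set `π(T) = π(σ(D₀ ∩ ker ℓ))`, and `y ↦ (P(ψ y - ψ p), ℓ(ψ y - ψ p))` trivialises the
flow on `T`. [cite: Anderson2000, §0] -/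
theorem IsStationaryKilling.exists_slice (h : g.IsStationaryKilling τ X univ)
    (hchr : g.IsChronological τ) (hθ : ContMDiff (𝓘(ℝ, ℝ).prod 𝓘(ℝ, E)) 𝓘(ℝ, E) 2 θ)
    (hθ0 : ∀ p, θ (0, p) = p) (hθadd : ∀ t s p, θ (t, θ (s, p)) = θ (t + s, p))
    (hθX : ∀ p, IsMIntegralCurve (fun t ↦ θ (t, p)) X) (p : M) :
    ∃ ψ ∈ IsManifold.maximalAtlas 𝓘(ℝ, E) ∞ M, ∃ ℓ : E →L[ℝ] ℝ, ∃ ε > (0 : ℝ), ∃ T : Set M,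
      ∃ D₀ : Set E, ℓ (show E from X p) = 1 ∧ IsOpen T ∧ p ∈ T ∧ T ⊆ ψ.source ∧ IsOpen D₀ ∧
      (0 : E) ∈ D₀ ∧
      (∀ w ∈ D₀, ℓ w = 0 → ψ p + w ∈ ψ.target ∧ ψ.symm (ψ p + w) ∈ T) ∧
      (∀ y ∈ T, ∀ s ∈ Ioo (-ε) ε,
        θ (s, y) ∈ ψ.source ∧ ψ (θ (s, y)) = ψ y + s • (show E from X p)) ∧
      (∀ y ∈ T, |ℓ (ψ y - ψ p)| < ε ∧
        (ψ y - ψ p) - ℓ (ψ y - ψ p) • (show E from X p) ∈ D₀ ∧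
        θ (-ℓ (ψ y - ψ p), y) =
          ψ.symm (ψ p + ((ψ y - ψ p) - ℓ (ψ y - ψ p) • (show E from X p)))) ∧
      (∀ w ∈ D₀, ℓ w = 0 → ∀ w' ∈ D₀, ℓ w' = 0 → ∀ t : ℝ,
        θ (t, ψ.symm (ψ p + w)) = ψ.symm (ψ p + w') → t = 0 ∧ w = w') := by
  have hv0 : X p ≠ 0 := by
    intro h0
    have ht := (h.isTimelike (mem_univ p)).1
    rw [LorentzianMetric.isTimelike_iff, h0, map_zero] at ht
    simp at ht
  -- the flow box (5b)
  have hX : ContMDiff 𝓘(ℝ, E) 𝓘(ℝ, E).tangent ∞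
      (fun x ↦ (⟨x, X x⟩ : TangentBundle 𝓘(ℝ, E) M)) := h.isKillingField.contMDiff
  obtain ⟨ψ, hψ, hpψ, -, hψv, ε, hε, N, hNo, hpN, hNψ, hbox⟩ :=
    Literature.Geometry.Manifold.exists_flowBox_flow_eq hX hθX hθ0 (p := p) hv0
  -- the functional (Hahn–Banach, Mathlib's `SeparatingDual.exists_eq_one`) and the projection
  have hv0' : (show E from X p) ≠ 0 := hv0
  obtain ⟨ℓ, hℓ⟩ := SeparatingDual.exists_eq_one (R := ℝ) hv0'
  -- no early returns (5c)
  obtain ⟨N₂, hN₂o, hpN₂, hret⟩ := h.exists_nhds_abs_lt_of_flow_mem hchr hθ hθ0 hθadd hθX p hε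
  -- the open set `D₀` of slice parameters and the tube `T`
  set D₀ : Set E := (fun w : E ↦ ψ p + w) ⁻¹' (ψ.target ∩ ψ.symm ⁻¹' (N ∩ N₂)) with hD₀
  have hD₀o : IsOpen D₀ := by
    have h1 : IsOpen (ψ.target ∩ ψ.symm ⁻¹' (N ∩ N₂)) :=
      ψ.symm.isOpen_inter_preimage (hNo.inter hN₂o)
    exact h1.preimage (continuous_const.add continuous_id)
  have h0D₀ : (0 : E) ∈ D₀ := by
    simp only [hD₀, mem_preimage, add_zero, mem_inter_iff]
    exact ⟨ψ.map_source hpψ, by rw [ψ.left_inv hpψ]; exact ⟨hpN, hpN₂⟩⟩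
  set A : Set E := {z | |ℓ (z - ψ p)| < ε ∧
    (z - ψ p) - ℓ (z - ψ p) • (show E from X p) ∈ D₀} with hA
  have hAo : IsOpen A := by
    have hc1 : Continuous fun z : E ↦ ℓ (z - ψ p) := ℓ.continuous.comp (continuous_id.sub continuous_const)
    have hc2 : Continuous fun z : E ↦ (z - ψ p) - ℓ (z - ψ p) • (show E from X p) :=
      (continuous_id.sub continuous_const).sub (hc1.smul continuous_const)
    exact (isOpen_lt (continuous_abs.comp hc1) continuous_const).inter (hD₀o.preimage hc2)
  set T : Set M := (N ∩ N₂) ∩ (ψ.source ∩ ψ ⁻¹' A) with hT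
  have hTo : IsOpen T := (hNo.inter hN₂o).inter (ψ.isOpen_inter_preimage hAo)
  have hpA : ψ p ∈ A := by
    simp only [hA, mem_setOf_eq, sub_self, map_zero, abs_zero, zero_smul]
    exact ⟨hε, h0D₀⟩
  have hpT : p ∈ T := ⟨⟨hpN, hpN₂⟩, hpψ, hpA⟩
  refine ⟨ψ, hψ, ℓ, ε, hε, T, D₀, hℓ, hTo, hpT, fun y hy ↦ hy.2.1, hD₀o, h0D₀, ?_, ?_, ?_, ?_⟩
  · -- (i) the slice lies in `T`
    intro w hw hℓw
    have hw' : ψ p + w ∈ ψ.target ∧ ψ.symm (ψ p + w) ∈ N ∩ N₂ := by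
      simpa only [hD₀, mem_preimage, mem_inter_iff] using hw
    refine ⟨hw'.1, hw'.2, ψ.map_target hw'.1, ?_⟩
    show ψ (ψ.symm (ψ p + w)) ∈ A
    rw [ψ.right_inv hw'.1]
    simp only [hA, mem_setOf_eq, add_sub_cancel_left, hℓw, abs_zero, zero_smul, sub_zero]
    exact ⟨hε, hw⟩
  · -- (ii) flow box on `T ⊆ N`
    intro y hy s hs
    exact ⟨(hbox y hy.1.1 s hs).2.1, (hbox y hy.1.1 s hs).2.2.2⟩
  · -- (iii) retraction onto the slice
    intro y hy
    have hyA : ψ y ∈ A := hy.2.2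
    simp only [hA, mem_setOf_eq] at hyA
    refine ⟨hyA.1, hyA.2, ?_⟩
    have hs : -ℓ (ψ y - ψ p) ∈ Ioo (-ε) ε := by
      obtain ⟨h1, h2⟩ := abs_lt.1 hyA.1
      exact ⟨by linarith, by linarith⟩
    rw [(hbox y hy.1.1 _ hs).2.2.1]
    congr 1
    rw [neg_smul]
    abel
  · -- (iv) the slice meets each orbit once
    intro w hw hℓw w' hw' hℓw' t ht
    have hwD : ψ p + w ∈ ψ.target ∧ ψ.symm (ψ p + w) ∈ N ∩ N₂ := by
      simpa only [hD₀, mem_preimage, mem_inter_iff] using hw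
    have hw'D : ψ p + w' ∈ ψ.target ∧ ψ.symm (ψ p + w') ∈ N ∩ N₂ := by
      simpa only [hD₀, mem_preimage, mem_inter_iff] using hw'
    -- no early return: `|t| < ε`
    have htε : |t| < ε := hret _ hwD.2.2 t (ht ▸ hw'D.2.2)
    -- chart identity: `ψ p + w + t v = ψ p + w'`
    have hkey := (hbox _ hwD.2.1 t (abs_lt.1 htε |> fun h ↦ ⟨h.1, h.2⟩)).2.2.2
    rw [ht, ψ.right_inv hw'D.1, ψ.right_inv hwD.1] at hkey
    -- `hkey : ψ p + w' = ψ p + w + t • v`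
    have hvec : w' = w + t • (show E from X p) := by
      have := congrArg (fun z ↦ z - ψ p) hkey
      simpa [add_sub_cancel_left, add_assoc] using this
    have ht0 : t = 0 := by
      have := congrArg ℓ hvec
      rw [map_add, map_smul, hℓw, hℓw', hℓ, smul_eq_mul, mul_one, zero_add] at this
      exact this.symm
    refine ⟨ht0, ?_⟩
    rw [hvec, ht0, zero_smul, add_zero]

end Slice

end LorentzianMetric

end Literature.Geometry.Lorentzian


end
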